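import Summits.HodgeConjecture.HodgeConjecture.Theses.IncidenceNodePeeling
import Literature.AlgebraicGeometry.HodgeTheory.AbsoluteHodgeClasses

/-!
# Birth skeleton (BC3) of the crux `HCRigidPairs` (stmt-HodgeConjecture-2349),
# route `IncidenceNodePeeling` — line `birth`: "rigid pairs are ℚ̄-pairs" (the absolute-Hodge /
# field-of-definition line that the route IMPORTS for its co-crux)

`HCRigidPairs` is the route's imported co-crux (rank 6, "NOT attacked by this route, owned by the
arithmetic/anchor lines"): for a smooth hypersurface `X ⊂ ℙ^{2p+1}_ℂ` of degree `d` and a rational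
class `ζ ∈ H^{2p}(X(ℂ); ℂ)` of Hodge type `(p,p)` whose pair `(X, ζ)` is NOT MOVABLE (no
non-isotrivial algebraic family of smooth degree-`d` hypersurfaces through `X` carries a global
rational class restricting to `ζ` and of type `(p,p)` on every fibre — equivalently, by the theorem
of the fixed part and Cattani–Deligne–Kaplan, the Hodge-locus component of `ζ` in `|𝒪(d)|` is a
finite union of `PGL_{2p+2}`-orbit closures), `ζ` is algebraic.

The line cuts the crux along the classical funnel of Voisin, *Hodge loci and absolute Hodge
classes* (Compositio 143 (2007) = arXiv:math/0605766, READ this session: Prop. 1.2, Rem. 1.3–1.4,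
Thm. 2.3 (= CDK), Lemma 2.4 p. 5) specialised to RIGID hypersurface pairs, where no spreading and
no compactification is needed (the pair itself descends):

  (X, ζ) rigid
    ⟹ (STUB 1, the transcendence input — OPEN) `ζ` is WEAKLY ABSOLUTE HODGE
      (`IsWeaklyAbsoluteHodgeClass`, Voisin Def. 2.1 on the tree's real carriers);
    ⟹ (STUB 2, FIELD OF DEFINITION — known in print modulo the tree: Voisin Lemma 2.4 "α weakly
      absolute ⟹ the Hodge locus of α is defined over ℚ̄" for the universal family of smooth
      degree-`d` hypersurfaces (defined over ℚ), + rigidity "the component through `[X]` is the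
      `PGL`-orbit closure" ⟹ the orbit, open dense in a ℚ̄-variety, has a ℚ̄-point `u`, and
      `X ≅ X_u = V(F_u)`, `F_u ∈ K[x]` for a number field `K`) `X` is DEFINABLE OVER A NUMBER FIELD
      (`X ≅ X₀ ×_{K,σ} ℂ`, the shape of `QbarEnvelope.HCOverNumberFields`);
    ⟹ (STUB 3, ARITHMETIC HC — OPEN, the anchor lines' target restricted to hypersurfaces) rational
      `(p,p)` middle classes on smooth even-dimensional hypersurfaces definable over a number field
      are algebraic.

The composition `HCRigidPairs_of` is then three lines of logic, kernel-checked, no `sorry`; the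
three stubs are genuinely different statements (transcendence / descent / arithmetic), none of
which is the crux or the summit reworded: STUB 1 is implied by HC (cycle classes are absolute
Hodge, Deligne 1982 Ex. 2.1(a)) but gives nothing algebraic without STUBS 2–3; STUB 2 is a theorem
in print; STUB 3 is HC on a COUNTABLE set of pairs (all `X₀/K`), neither implying nor implied by the
crux cheaply (a ℚ̄-pair may be movable, e.g. Fermat members of positive-dimensional Hodge loci,
Aljovin–Movasati–Villaflor 2019; a rigid pair is a ℚ̄-pair only through STUBS 1–2).

## Contents

* `Movable p d X ζ` — the route's MOVABLE predicate, VERBATIM the negated hypothesis of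
  `HCRigidPairs` (checked by `hcRigidPairs_iff`, `Iff.rfl`);
* `IsDefinableOverNumberField X` — `∃ K number field, σ : K →+* ℂ, X₀/K, X ≅ X₀ ×_{K,σ} ℂ`
  (verbatim the hypothesis shape of `QbarEnvelope.HCOverNumberFields`, stmt-HodgeConjecture-1070);
* `stub_weaklyAbsolute_of_rigid` (STUB 1, open, the load-bearing stub),
  `stub_numberField_of_rigid_weaklyAbsolute` (STUB 2, in print: Voisin 2007 Lemma 2.4 + CDK + orbit
  density, L-sized in the tree), `stub_hodge_of_numberField_hypersurface` (STUB 3, open, arithmetic)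
  — `sorry` ONLY here;
* `HCRigidPairs_of` — the composition stub₁ → stub₂ → stub₃ → the crux BY NAME
  (`Summit.HodgeConjecture.HodgeConjecture.Theses.IncidenceNodePeeling.HCRigidPairs`), no `sorry`;
  `HCRigidPairs_of_stubs` — the crux modulo exactly the three stubs.

Disproof used: none on file (`Cruxes/HCRigidPairs/` had no `Disproof.lean`, no ideas, no lines at
registration, `ledger crux ls stmt-HodgeConjecture-2349`: "(no workfiles yet)"); the item carries no
`_false_without_` theorem and `ledger negatives` lists no statement about rigid pairs.
-/

noncomputable section

namespace Summit.HodgeConjecture.HodgeConjecture.Cruxes.HCRigidPairs.Birth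

open CategoryTheory AlgebraicGeometry
open Literature.AlgebraicGeometry.Motives Literature.AlgebraicGeometry.HodgeTheory
open Summit.HodgeConjecture.HodgeConjecture.Theses.IncidenceNodePeeling (HCRigidPairs)

/-! ### The two predicates of the cut -/

/-- **MOVABLE pair** — verbatim the existential negated in the hypothesis of the route decl
`HCRigidPairs` (and asserted in `HCMovablePairs`): there is a smooth projective family
`f : 𝒳 → S` of smooth degree-`d` hypersurfaces of dimension `2p` over an irreducible base locally
of finite type, with marked fibre `𝒳_s ≅ X`, some fibre not isomorphic to `𝒳_s`, and a rational
class `Ξ` on `𝒳(ℂ)` of type `(p,p)` on every fibre restricting to `ζ` on `𝒳_s` — i.e. the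
Hodge-locus component of `ζ` is positive-dimensional modulo `PGL_{2p+2}` (theorem of the fixed part
+ Cattani–Deligne–Kaplan). [cite: CattaniDeligneKaplan1995, Thm. 1.1] [cite: Voisin2007HodgeLoci, Thm. 2.3] -/
def Movable (p d : ℕ) (X : SchemeOver ℂ) (ζ : complexBetti X (2 * p)) : Prop :=
  ∃ (S 𝒳 : SchemeOver ℂ) (f : 𝒳 ⟶ S) (s : ComplexPoints S) (e : fiberOver f s ≅ X)
    (Ξ : complexBetti 𝒳 (2 * p)),
    IsSmoothProjectiveFamily f (2 * p) ∧ LocallyOfFiniteType S.hom ∧ IrreducibleSpace S.left ∧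
      (∀ t : ComplexPoints S, IsSmoothHypersurface (2 * p) d (fiberOver f t)) ∧
      (∃ t : ComplexPoints S, IsEmpty (fiberOver f t ≅ fiberOver f s)) ∧
      IsRationalClass Ξ ∧
      (∀ t : ComplexPoints S,
        IsOfHodgeType (2 * p) (fiberOver f t) (2 * p) p p
          ((complexBetti.map (fiberι f t) (2 * p)).hom Ξ)) ∧
      (complexBetti.map (fiberι f s) (2 * p)).hom Ξ = (complexBetti.map e.hom (2 * p)).hom ζ

/-- **Definable over a number field**: `X ≅ X₀ ×_{K,σ} ℂ` for some number field `K`, embedding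
`σ : K →+* ℂ` and `K`-scheme `X₀` — verbatim the hypothesis of
`Summit.HodgeConjecture.HodgeConjecture.Theses.QbarEnvelope.HCOverNumberFields`
(stmt-HodgeConjecture-1070) and the conclusion shape of Voisin's reduction.
[cite: Voisin2007HodgeLoci, Prop. 1.2 and Rem. 1.4] -/
def IsDefinableOverNumberField (X : SchemeOver ℂ) : Prop :=
  ∃ (K : Type) (_ : Field K) (_ : NumberField K) (σ : K →+* ℂ) (X₀ : SchemeOver K),
    Nonempty (X ≅ (baseChangeHom σ).obj X₀)

/-- `Movable` is VERBATIM the route's predicate: the crux unfolds, definitionally, to "rigid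
(`¬ Movable`) rational `(p,p)` middle classes on smooth even-dimensional hypersurfaces are
algebraic". [folklore] -/
theorem hcRigidPairs_iff :
    HCRigidPairs ↔
      ∀ (p d : ℕ) (X : SchemeOver ℂ) (ζ : complexBetti X (2 * p)),
        IsSmoothHypersurface (2 * p) d X → IsRationalClass ζ →
          IsOfHodgeType (2 * p) X (2 * p) p p ζ → ¬ Movable p d X ζ → ζ ∈ algebraicClasses X p :=
  Iff.rfl

/-! ### The three registered stubs -/

/-- STUB 1 (THE TRANSCENDENCE INPUT; open — load-bearing) — **Hodge classes of rigid hypersurface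
pairs are weakly absolute Hodge.** For `X ⊂ ℙ^{2p+1}_ℂ` a smooth hypersurface of degree `d` and
`ζ` a rational `(p,p)` class with `(X, ζ)` rigid (`¬ Movable`), every conjugate `ζ^τ` on `X^τ`,
`τ ∈ Aut ℂ`, is `(2πi/τ(2πi))ᵖ · t · β` with `β` rational of type `(p,p)` and `t ∈ ℚ̄` (Voisin
Def. 2.1 on the tree's carriers, `IsWeaklyAbsoluteHodgeClass`). Why plausibly true: it follows from
HC (cycle classes are absolute Hodge, Deligne 1982 Ex. 2.1(a); Charles–Schnell §11.2.2) and is the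
standing expectation "Hodge classes are absolute"; for hypersurfaces the universal family contains
the Fermat point, where all Hodge classes are absolute (Shioda/Deligne), and rigidity makes the set
of pairs to be treated countable modulo `Aut ℂ`-conjugation IF the conjugates of Hodge loci are
Hodge loci — which is exactly the content. Why it might fail / why it is hard: Voisin's criterion
(Thm. 1.5: no constant sub-VHS on the component but `ℚα`) addresses the OPPOSITE, maximal-variation
regime — on a rigid component the VHS is isotrivial, every sub-Hodge structure is constant, and the
criterion is void; no method is known at an isolated point of the Hodge locus with transcendental
parameter ("does not say anything about the definition field of an isolated point in the Hodge
locus", Voisin p. 2). A rigid pair with a NON-weakly-absolute class would be a counterexample to HC.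
Size: open problem (the crux's real content). Leans on: `IsWeaklyAbsoluteHodgeClass`,
`IsConjugateClass`, `periodTwist` (AbsoluteHodgeClasses); nothing proved in the tree bears on it.
[cite: Voisin2007HodgeLoci, Def. 2.1, Thm. 1.5 and p. 2] [cite: Deligne1982HodgeCycles, §2 Ex. 2.1(a)]
[cite: CharlesSchnell2014Notes, Def. 11.2.3 and §11.3] -/
theorem stub_weaklyAbsolute_of_rigid :
    ∀ (p d : ℕ) (X : SchemeOver ℂ) (ζ : complexBetti X (2 * p)),
      IsSmoothHypersurface (2 * p) d X → IsRationalClass ζ →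
        IsOfHodgeType (2 * p) X (2 * p) p p ζ → ¬ Movable p d X ζ →
          IsWeaklyAbsoluteHodgeClass (2 * p) X p ζ := by
  sorry

/-- STUB 2 (FIELD OF DEFINITION; known in print, L-sized in the tree) — **a rigid pair with weakly
absolute class is definable over a number field.** Proof in print: the universal family
`𝒴 → U = |𝒪_{ℙ^{2p+1}}(d)|_sm` is defined over `ℚ` (tree: `Motives.UniversalHypersurface.family`);
by Voisin 2007 Lemma 2.4 (weakly absolute ⟹ the connected component `S̃_ζ` of the locus of Hodge
classes through `ζ`, algebraic by Cattani–Deligne–Kaplan = her Thm. 2.3, and its image `Z_ζ ⊆ U`,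
are defined over `ℚ̄`); rigidity (`¬ Movable`: otherwise an irreducible curve in `Z_ζ` through
`[X]` leaving the orbit closure, normalised, with Deligne's global invariant class `Ξ` on the family
over it, is a MOVABLE witness) makes the irreducible component of `Z_ζ` through `[X]` the closure of
the orbit `PGL_{2p+2}(ℂ)·[X]`, itself inside `Z_ζ`; an irreducible `ℚ̄`-closed set has dense
`ℚ̄`-points (Lang III §5) and the orbit is constructible and dense in it, so some `u ∈ U(ℚ̄)` has
`X ≅ X_u = V₊(F_u)` with `F_u ∈ K[x₀,…,x_{2p+1}]`, `K` a number field, i.e. `X ≅ X₀ ×_{K,σ} ℂ`. Why it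
might fail: in print it does not; in the tree it needs the Hodge-locus components of the universal
family as algebraic sets with their fields of definition (`HodgeLocus.IsDefinedOverQbar` exists;
CDK is the barrier fact `CattaniDeligneKaplan1995_hodgeLocus_algebraicFor`, used positively), the
global invariant cycle theorem (tree: `GlobalInvariantCycles`) and `V₊(F) ×_K ℂ ≅ V₊(σF)`. Degenerate
ranges are consistent: `d ≤ 2` or `p = 0` (all pairs rigid, `X` a quadric / projective space /
point, defined over `ℚ`). Size: L. Leans on: `Motives.UniversalHypersurface.family`,
`isSmoothHypersurface_fiberOver`, `IsSmoothHypersurface.of_iso`, `HodgeLocus.locusOfHodgeClasses`,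
`HodgeLocusComponent.IsBaseDefinedOverQbar`, `globalInvariantCycles`-layer, `Motives.baseChangeHom`.
[cite: Voisin2007HodgeLoci, Lemma 2.4 and Thm. 2.3] [cite: CattaniDeligneKaplan1995, Thm. 1.1]
[cite: Lang1958IAG, Ch. III §5] -/
theorem stub_numberField_of_rigid_weaklyAbsolute :
    ∀ (p d : ℕ) (X : SchemeOver ℂ) (ζ : complexBetti X (2 * p)),
      IsSmoothHypersurface (2 * p) d X → ¬ Movable p d X ζ →
        IsWeaklyAbsoluteHodgeClass (2 * p) X p ζ → IsDefinableOverNumberField X := by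
  sorry

/-- STUB 3 (ARITHMETIC HC FOR HYPERSURFACE PAIRS OVER NUMBER FIELDS; open) — **on a smooth
even-dimensional hypersurface definable over a number field, every rational `(p,p)` middle class is
algebraic.** The hypersurface / middle-degree restriction of `QbarEnvelope.HCOverNumberFields`
(stmt-HodgeConjecture-1070: HC for all smooth projective `X ≅ X₀ ×_{K,σ} ℂ`), by which it is implied
(`IsSmoothHypersurface.1 : IsSmoothProjective`); a COUNTABLE family of pairs where a Hodge class
has arithmetic incarnations absent at transcendental parameters (algebraic de Rham class over a
finite extension, crystalline Frobenii, one ℓ-adic Galois representation: Hodge ⟹ Tate under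
absoluteness, Tate + Mumford–Tate ⟹ HC; p-adic variational Hodge, Bloch–Esnault–Kerz). Why it might
fail: it is HC on ℚ̄-hypersurfaces — open beyond the classical `(p,d)` and the Fermat degrees of
`hodgeClasses_algebraic_fermat` (Shioda: `m` prime or `m ≤ 20`); unverified Hodge classes on Fermat
`X^{2p}_m`, `m` composite `> 21`, are the first suspects (Shioda 1979; arXiv:2312.09268). Neither
implies nor is implied by the crux cheaply: a ℚ̄-pair may be movable (Fermat members of
positive-dimensional Hodge loci), a rigid pair is a ℚ̄-pair only via STUBS 1–2. Size: open problem
(shared with the anchor routes). Leans on: `QbarEnvelope.HCOverNumberFields` (item, implies it),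
`hodgeClasses_algebraic_fermat` (named fact, Fermat cases), `Motives.baseChangeHom`.
[cite: Voisin2007HodgeLoci, Prop. 1.2] [cite: Shioda1979HodgeFermat, Thm. IV]
[cite: BlochEsnaultKerz2014pAdic, Thm. 1.3] -/
theorem stub_hodge_of_numberField_hypersurface :
    ∀ (p d : ℕ) (X : SchemeOver ℂ) (ζ : complexBetti X (2 * p)),
      IsSmoothHypersurface (2 * p) d X → IsDefinableOverNumberField X → IsRationalClass ζ →
        IsOfHodgeType (2 * p) X (2 * p) p p ζ → ζ ∈ algebraicClasses X p := by
  sorry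

/-! ### The composition: stub₁ → stub₂ → stub₃ → the crux, by name -/

/-- **THE LINE'S COMPOSITION** (kernel-checked, no `sorry`): if rigid pairs carry weakly absolute
classes (STUB 1), rigid pairs with weakly absolute class are definable over a number field
(STUB 2), and rational `(p,p)` middle classes on hypersurfaces definable over a number field are
algebraic (STUB 3), then `HCRigidPairs` — for a rigid pair `(X, ζ)`, STUB 1 gives weak
absoluteness, STUB 2 a number-field model of `X`, STUB 3 the algebraicity of `ζ` on that `X`.
[cite: Voisin2007HodgeLoci, Prop. 1.2 and Lemma 2.4] -/
theorem HCRigidPairs_of :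
    (∀ (p d : ℕ) (X : SchemeOver ℂ) (ζ : complexBetti X (2 * p)),
      IsSmoothHypersurface (2 * p) d X → IsRationalClass ζ →
        IsOfHodgeType (2 * p) X (2 * p) p p ζ → ¬ Movable p d X ζ →
          IsWeaklyAbsoluteHodgeClass (2 * p) X p ζ) →
    (∀ (p d : ℕ) (X : SchemeOver ℂ) (ζ : complexBetti X (2 * p)),
      IsSmoothHypersurface (2 * p) d X → ¬ Movable p d X ζ →
        IsWeaklyAbsoluteHodgeClass (2 * p) X p ζ → IsDefinableOverNumberField X) →
    (∀ (p d : ℕ) (X : SchemeOver ℂ) (ζ : complexBetti X (2 * p)),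
      IsSmoothHypersurface (2 * p) d X → IsDefinableOverNumberField X → IsRationalClass ζ →
        IsOfHodgeType (2 * p) X (2 * p) p p ζ → ζ ∈ algebraicClasses X p) →
    Summit.HodgeConjecture.HodgeConjecture.Theses.IncidenceNodePeeling.HCRigidPairs := by
  intro h₁ h₂ h₃ p d X ζ hX hq hpp hrig
  exact h₃ p d X ζ hX (h₂ p d X ζ hX hrig (h₁ p d X ζ hX hq hpp hrig)) hq hpp

/-- **The crux, closed modulo exactly the three registered stubs.** -/
theorem HCRigidPairs_of_stubs :
    Summit.HodgeConjecture.HodgeConjecture.Theses.IncidenceNodePeeling.HCRigidPairs :=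
  HCRigidPairs_of stub_weaklyAbsolute_of_rigid stub_numberField_of_rigid_weaklyAbsolute
    stub_hodge_of_numberField_hypersurface

end Summit.HodgeConjecture.HodgeConjecture.Cruxes.HCRigidPairs.Birth

end
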